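import Mathlib
import Literature.NumberTheory.LFunctions.Zhang2022.TypedAppendixB
import Literature.NumberTheory.LFunctions.Zhang2022.AppendixBVarrhoB1
import Literature.NumberTheory.LFunctions.Zhang2022.AppendixBVarrhoB2
import Literature.NumberTheory.LFunctions.HalaszPartialSummation
import HarnessLib

/-!
# Zhang (2022), Appendix B: the typed nodes (B.1), (B.2), §B.u002–u004, §B.u006 DISCHARGED

Topic `Literature/NumberTheory/LFunctions/Zhang2022` (Landau–Siegel audit tree; verdict-neutral).
Y. Zhang, *Discrete mean estimates and the Landau–Siegel zero*, arXiv:2211.02515v1 (2022)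
[Zhang2022LandauSiegel] — **an unrefereed manuscript under adjudication**. The cell's typed statement
file `Zhang2022.TypedAppendixB` (namespace `…Typed.AppendixB`) states the displays of the proof of
Lemma 15.1 (Appendix B, pp. 106–107) as `Prop`s; this file PROVES six of them from the kernel theorems
of `AppendixBVarrho`, `AppendixBVarrhoB1Core`, `AppendixBVarrhoB1`, `AppendixBVarrhoB2`:

* `eqB_1_holds : EqB_1 c′` — **(B.1)** (under (A); last step from Lemma 3.1 + Cauchy–Schwarz, see
  `AppendixBVarrhoB1`; the source's "with Lemma 3.2" does not apply);
* `eqB_2_holds : EqB_2 c′` — **(B.2)** (unconditional);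
* `stepB_u002_holds : StepB_u002` — "`χ(d) = μ(d) + O(Σ_{h∣d,h>1} ν(h))`", constant `1`;
* `stepB_u003_holds : StepB_u003 c′` — "`ϱ_j(n) − ϱ*_j(n) ≪ Σ_{h∣n,h>1} ν(h)τ₂(n/h)`", constant `1`;
* `stepB_u004_holds : StepB_u004 c′` — the substitution `n = hm` and "`Σ_{m<P/h} τ₂(m)/m ≪ (log P)²`",
  constant `9`;
* `stepB_u006_holds : StepB_u006 c′` — "By (B.1) and (B.2), `Σ_{(l,𝔮)=1} ϰ_μ(l₁l)ϱ*_j(l)/l =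
  Σ_l ϰ_μ(l₁l)ϱ_j(l)/l + O(𝓛⁻⁸)`" for `ϰ₂, ϰ₃` (`|ϰ_μ(n)| ≤ 1`: the tree's `Skeleton.norm_vk2_le/vk3_le`).

NOT here: `StepB_u004h`, `StepB_u005a`, `StepB_u007`ff (other seats of the cell), and `StepB_u005` —
which is not provable AS TYPED: it shares one constant between the `O(1/q²)` inside the Euler product
`∏_{q<P}(1 + |ϱ_j(q)|/q + O(q⁻²))` and the final `≪`, whereas the product exceeds `∏_p(1 + C/p²)`, which
outgrows `C`; the source's sentence (two independent implied constants) is fine and its content is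
`AppendixBVarrho.sum_norm_rho_div_not_coprime_le` + `AppendixBVarrhoB2.appB2_bound`. DAG nodes (cell
siegel-zhang): `Z22:(B.1)`, `Z22:(B.2)`, `Z22:§B.u002`, `§B.u003`, `§B.u004`, `§B.u006`. No claim about
Theorems 1–2 of the source or about Landau–Siegel zeros is made.
-/

noncomputable section

open Complex Real Finset ArithmeticFunction

namespace Literature.NumberTheory.LFunctions.Zhang2022.AppendixBVarrho

open Literature.NumberTheory.LFunctions.Zhang2022 Skeleton Typed.AppendixB

/-! ## Small range lemmas -/

/-- `[1, N) = [1, N−1]` in `ℕ`. [folklore] -/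
private theorem Ico_one_eq_Icc (N : ℕ) : Finset.Ico 1 N = Finset.Icc 1 (N - 1) := by
  ext n; simp only [Finset.mem_Ico, Finset.mem_Icc]; omega

/-- `⌈P⌉ − 1 ≤ ⌊P²⌋` for `P ≥ 1`. [folklore] -/
private theorem ceil_sub_one_le_floor_sq {P : ℝ} (hP : 1 ≤ P) : ⌈P⌉₊ - 1 ≤ ⌊P ^ 2⌋₊ := by
  have h1 : ⌈P⌉₊ - 1 ≤ ⌊P⌋₊ := by
    have := Nat.ceil_le_floor_add_one P
    omega
  exact h1.trans (Nat.floor_le_floor (by nlinarith))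

/-- `Re β_j = 0` ((2.13); private copy of the tree's `Skeleton.betaJ_re`). [cite: Zhang2022LandauSiegel, §2 (2.13)] -/
private theorem betaJ_re'' (c' : ℝ) (D j : ℕ) : (betaJ c' D j).re = 0 := by
  unfold betaJ beta1 beta2 beta3
  split_ifs <;> simp

/-- On the divisors of `d`, "`1 < h`" and "`h ≠ 1`" select the same terms. [folklore] -/
private theorem divisors_filter_one_lt (d : ℕ) :
    d.divisors.filter (fun h => 1 < h) = d.divisors.erase 1 := by
  ext h
  simp only [mem_filter, mem_erase, Nat.mem_divisors]
  constructor
  · rintro ⟨⟨hh, hd⟩, h1⟩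
    exact ⟨by omega, hh, hd⟩
  · rintro ⟨h1, hh, hd⟩
    have : h ≠ 0 := fun h0 => by subst h0; exact hd (Nat.eq_zero_of_zero_dvd hh)
    exact ⟨⟨hh, hd⟩, by omega⟩

/-- `Σ_{m≤X} τ₂(m)/m ≤ (Σ_{k≤X} 1/k)·(Σ_{k≤X} 1/k)`. [folklore] -/
private theorem sum_card_divisors_div_le_mul (X : ℕ) :
    ∑ m ∈ Icc 1 X, (m.divisors.card : ℝ) / m ≤
      (∑ k ∈ Icc 1 X, (1 : ℝ) / k) * ∑ k ∈ Icc 1 X, (1 : ℝ) / k := by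
  have h1 : ∑ m ∈ Icc 1 X, (m.divisors.card : ℝ) / m =
      ∑ m ∈ Icc 1 X, ∑ d ∈ m.divisors, (1 : ℝ) / m := by
    refine sum_congr rfl fun m _ => ?_
    rw [sum_const, nsmul_eq_mul, mul_one_div]
  rw [h1, Halasz.sum_Icc_sum_divisors_eq (fun _ m => (1 : ℝ) / m) X, sum_mul]
  refine sum_le_sum fun d hd => ?_
  have hd0 : (0 : ℝ) < d := by simp only [mem_Icc] at hd; exact_mod_cast hd.1
  rw [mul_sum]
  calc ∑ m ∈ Icc 1 (X / d), (1 : ℝ) / ((d * m : ℕ) : ℝ)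
      ≤ ∑ m ∈ Icc 1 X, (1 : ℝ) / ((d * m : ℕ) : ℝ) := by
        refine sum_le_sum_of_subset_of_nonneg ?_ fun m _ _ => by positivity
        intro m hm; simp only [mem_Icc] at hm ⊢; exact ⟨hm.1, hm.2.trans (Nat.div_le_self X d)⟩
    _ = ∑ m ∈ Icc 1 X, 1 / (d : ℝ) * (1 / m) := by
        refine sum_congr rfl fun m _ => ?_
        push_cast
        rw [one_div_mul_one_div]

/-- The basic facts for `D ≥ 3`: `1 ≤ 𝓛`, `e ≤ P`, `2 ≤ D`. [cite: Zhang2022LandauSiegel, §2 (2.1), (2.6)] -/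
private theorem basics {D : ℕ} (hD : 3 ≤ D) : 1 ≤ ell D ∧ Real.exp 1 ≤ bigP D ∧ 2 ≤ D := by
  obtain ⟨hℓ, -, -, -⟩ := params_of_three_le hD
  refine ⟨hℓ, ?_, by omega⟩
  unfold bigP
  exact Real.exp_le_exp.mpr (by nlinarith [one_le_pow₀ (n := 9) hℓ])

/-! ## (B.2) and (B.1) as typed -/

/-- **(B.2) holds** (typed node `Typed.AppendixB.EqB_2`, DAG `Z22:(B.2)`): unconditionally, by
`appB2_bound` on the range `[1, ⌈P⌉)`. [cite: Zhang2022LandauSiegel, App. B (B.2), p.106] -/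
theorem eqB_2_holds (c' : ℝ) : EqB_2 c' := by
  obtain ⟨C, D₀, h⟩ := appB2_bound c'
  refine ⟨C, max D₀ 3, fun D _ χ hD hq hp j _ => ?_⟩
  have hD3 : 3 ≤ D := le_trans (le_max_right _ _) hD
  obtain ⟨-, hP, -⟩ := basics hD3
  have hP1 : 1 ≤ bigP D := le_trans (by linarith [Real.add_one_le_exp (1 : ℝ)]) hP
  have hX := h D χ (le_trans (le_max_left _ _) hD) hq hp j (⌈bigP D⌉₊ - 1)
    (ceil_sub_one_le_floor_sq hP1)
  rw [Ico_one_eq_Icc]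
  exact hX

variable (c' : ℝ) in
/-- `EqB_2` — `_holds` alias of `eqB_2_holds` above under the fact's exact name, stated under the
prover's own binders as section variables (appended 2026-08-28, D-0026 bookkeeping: the proof term is the
existing theorem of this file; no statement, definition or attribute is edited; no new named fact; the
ledger's debt table listed the fact unproved). [cite: Zhang2022LandauSiegel, App. B (B.2), p.106] -/
theorem _root_.Literature.NumberTheory.LFunctions.Zhang2022.Typed.AppendixB.EqB_2_holds :
    _root_.Literature.NumberTheory.LFunctions.Zhang2022.Typed.AppendixB.EqB_2 c' :=
  _root_.Literature.NumberTheory.LFunctions.Zhang2022.AppendixBVarrho.eqB_2_holds (c' := c')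

/-- **(B.1) holds** (typed node `Typed.AppendixB.EqB_1`, DAG `Z22:(B.1)`): under (A), by `appB1_bound`
on the range `[1, ⌈P⌉)` (last step from Lemma 3.1 + Cauchy–Schwarz — see `AppendixBVarrhoB1`).
[cite: Zhang2022LandauSiegel, App. B (B.1), p.106] -/
theorem eqB_1_holds (c' : ℝ) : EqB_1 c' := by
  obtain ⟨C, D₀, h⟩ := appB1_bound c'
  refine ⟨C, max D₀ 3, fun D _ χ hD hq hp hA j _ => ?_⟩
  have hD3 : 3 ≤ D := le_trans (le_max_right _ _) hD
  obtain ⟨-, hP, -⟩ := basics hD3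
  have hP1 : 1 ≤ bigP D := le_trans (by linarith [Real.add_one_le_exp (1 : ℝ)]) hP
  have hX := h D χ (le_trans (le_max_left _ _) hD) hq hp hA j (⌈bigP D⌉₊ - 1)
    (ceil_sub_one_le_floor_sq hP1)
  rw [Ico_one_eq_Icc]
  exact hX

variable (c' : ℝ) in
/-- `EqB_1` — `_holds` alias of `eqB_1_holds` above under the fact's exact name, stated under the
prover's own binders as section variables (appended 2026-08-28, D-0026 bookkeeping: the proof term is the
existing theorem of this file; no statement, definition or attribute is edited; no new named fact; the
ledger's debt table listed the fact unproved). [cite: Zhang2022LandauSiegel, App. B (B.1), p.106] -/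
theorem _root_.Literature.NumberTheory.LFunctions.Zhang2022.Typed.AppendixB.EqB_1_holds :
    _root_.Literature.NumberTheory.LFunctions.Zhang2022.Typed.AppendixB.EqB_1 c' :=
  _root_.Literature.NumberTheory.LFunctions.Zhang2022.AppendixBVarrho.eqB_1_holds (c' := c')

/-! ## The steps §B.u002, §B.u003, §B.u004 -/

/-- **§B.u002 holds** (`Typed.AppendixB.StepB_u002`): "`χ(d) = μ(d) + O(Σ_{h∣d, h>1} ν(h))`" with
constant `1` (`norm_chi_sub_moebius_le`). [cite: Zhang2022LandauSiegel, App. B p.106] -/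
theorem stepB_u002_holds : StepB_u002 := by
  refine ⟨1, fun D _ χ d hd => ?_⟩
  rw [one_mul, divisors_filter_one_lt]
  exact norm_chi_sub_moebius_le χ (by omega)

/-- `StepB_u002` — `_holds` alias of `stepB_u002_holds` above under the fact's exact name (appended
2026-08-28, D-0026 bookkeeping: the proof term is the existing theorem of this file; no statement,
definition or attribute is edited; no new named fact; the ledger's debt table listed the fact
unproved). [cite: Zhang2022LandauSiegel, App. B p.106] -/
theorem _root_.Literature.NumberTheory.LFunctions.Zhang2022.Typed.AppendixB.StepB_u002_holds :
    StepB_u002 :=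
  _root_.Literature.NumberTheory.LFunctions.Zhang2022.AppendixBVarrho.stepB_u002_holds

/-- **§B.u003 holds** (`Typed.AppendixB.StepB_u003 c′`): "`ϱ_j(n) − ϱ*_j(n) ≪ Σ_{h∣n,h>1} ν(h)τ₂(n/h)`"
with constant `1` (`norm_varrho_sub_le`; `β_j` is purely imaginary). [cite: Zhang2022LandauSiegel, App. B p.106] -/
theorem stepB_u003_holds (c' : ℝ) : StepB_u003 c' := by
  refine ⟨1, fun D _ χ j _ n hn => ?_⟩
  rw [one_mul, divisors_filter_one_lt]
  have h := norm_varrho_sub_le χ (betaJ_re'' c' D j) (n := n) (by omega)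
  simp only [mul_comm (((n / _ : ℕ).divisors.card : ℝ))] at h
  exact h

variable (c' : ℝ) in
/-- `StepB_u003` — `_holds` alias of `stepB_u003_holds` above under the fact's exact name, stated under the
prover's own binders as section variables (appended 2026-08-28, D-0026 bookkeeping: the proof term is the
existing theorem of this file; no statement, definition or attribute is edited; no new named fact; the
ledger's debt table listed the fact unproved). [cite: Zhang2022LandauSiegel, App. B p.106] -/
theorem _root_.Literature.NumberTheory.LFunctions.Zhang2022.Typed.AppendixB.StepB_u003_holds :
    _root_.Literature.NumberTheory.LFunctions.Zhang2022.Typed.AppendixB.StepB_u003 c' :=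
  _root_.Literature.NumberTheory.LFunctions.Zhang2022.AppendixBVarrho.stepB_u003_holds (c' := c')

/-- **§B.u004 holds** (`Typed.AppendixB.StepB_u004 c′`): "by substituting `n = hm`,
`Σ_{n<P,(n,𝔮)=1}|ϱ_j − ϱ*_j|(n)/n ≪ Σ_{h>D⁴} ν(h)/h Σ_{m<P/h} τ₂(m)/m ≪ (log P)² Σ_{D⁴<h<P} ν(h)/h`",
both relations with the constant `9` (`sum_coprime_norm_sub_le_swap`; `Σ_{m≤N} τ₂(m)/m ≤ (Σ_{k≤N} 1/k)²
≤ (1 + log⌈P⌉)² ≤ 9 log²P` for `D ≥ 3`). [cite: Zhang2022LandauSiegel, App. B p.106] -/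
theorem stepB_u004_holds (c' : ℝ) : StepB_u004 c' := by
  refine ⟨9, 3, fun D _ χ hD hq hp _ j _ => ?_⟩
  obtain ⟨hℓ, hP, hD2⟩ := basics hD
  have hP1 : 1 ≤ bigP D := le_trans (by linarith [Real.add_one_le_exp (1 : ℝ)]) hP
  have hP0 : 0 < bigP D := by linarith
  have hlogP : 1 ≤ Real.log (bigP D) := by
    rw [← Real.log_exp 1]; exact Real.log_le_log (Real.exp_pos 1) hP
  set X : ℕ := ⌈bigP D⌉₊ - 1 with hXdef
  have hceil1 : 1 ≤ ⌈bigP D⌉₊ := Nat.one_le_iff_ne_zero.mpr (by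
    intro h0; have := Nat.ceil_eq_zero.mp h0; linarith)
  have hXlt : (X : ℝ) < bigP D := by
    have h1 : ((⌈bigP D⌉₊ - 1 : ℕ) : ℝ) = (⌈bigP D⌉₊ : ℝ) - 1 := by
      rw [Nat.cast_sub hceil1, Nat.cast_one]
    rw [hXdef, h1]
    linarith [Nat.ceil_lt_add_one hP0.le]
  set ν : ℕ → ℝ := fun h => ‖nu χ h‖ with hν
  -- the inner `m`-sums: monotone in the range, and `≤ 9 log²P` on `[1, ⌈P⌉]`
  have hinner_mono : ∀ h : ℕ, 1 ≤ h →
      ∑ m ∈ Icc 1 (X / h), ((m.divisors.card : ℝ) / m) ≤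
        ∑ m ∈ Finset.Ico 1 ⌈bigP D / h⌉₊, ((m.divisors.card : ℝ) / m) := by
    intro h hh
    refine sum_le_sum_of_subset_of_nonneg ?_ fun m _ _ => by positivity
    intro m hm
    rw [mem_Icc] at hm
    rw [Finset.mem_Ico]
    refine ⟨hm.1, Nat.lt_ceil.mpr ?_⟩
    have hh0 : (0 : ℝ) < h := by exact_mod_cast hh
    rw [lt_div_iff₀ hh0]
    have hmh : m * h ≤ X := (Nat.le_div_iff_mul_le hh).mp hm.2
    calc (m : ℝ) * h = ((m * h : ℕ) : ℝ) := by push_cast; ring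
      _ ≤ X := by exact_mod_cast hmh
      _ < bigP D := hXlt
  have hinner_le : ∀ h : ℕ, 1 ≤ h →
      ∑ m ∈ Finset.Ico 1 ⌈bigP D / h⌉₊, ((m.divisors.card : ℝ) / m) ≤ 9 * Real.log (bigP D) ^ 2 := by
    intro h hh
    have hsub : Finset.Ico 1 ⌈bigP D / h⌉₊ ⊆ Icc 1 ⌈bigP D⌉₊ := by
      intro m hm
      rw [Finset.mem_Ico] at hm
      rw [mem_Icc]
      refine ⟨hm.1, (Nat.le_of_lt_succ (Nat.lt_succ_of_lt hm.2)).trans (Nat.ceil_mono ?_)⟩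
      exact div_le_self hP0.le (by exact_mod_cast hh)
    have hH : ∑ k ∈ Icc 1 ⌈bigP D⌉₊, (1 : ℝ) / k ≤ 3 * Real.log (bigP D) := by
      have h1 := Literature.NumberTheory.Sieve.sum_Icc_one_div_le_one_add_log ⌈bigP D⌉₊
      have h2 : Real.log (⌈bigP D⌉₊ : ℝ) ≤ Real.log 2 + Real.log (bigP D) := by
        rw [← Real.log_mul (by norm_num) hP0.ne']
        exact Real.log_le_log (by exact_mod_cast hceil1) (by linarith [Nat.ceil_lt_add_one hP0.le])
      linarith [Real.log_two_lt_d9]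
    calc ∑ m ∈ Finset.Ico 1 ⌈bigP D / h⌉₊, ((m.divisors.card : ℝ) / m)
        ≤ ∑ m ∈ Icc 1 ⌈bigP D⌉₊, ((m.divisors.card : ℝ) / m) :=
          sum_le_sum_of_subset_of_nonneg hsub fun m _ _ => by positivity
      _ ≤ (∑ k ∈ Icc 1 ⌈bigP D⌉₊, (1 : ℝ) / k) * ∑ k ∈ Icc 1 ⌈bigP D⌉₊, (1 : ℝ) / k :=
          sum_card_divisors_div_le_mul ⌈bigP D⌉₊
      _ ≤ (3 * Real.log (bigP D)) * (3 * Real.log (bigP D)) := by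
          gcongr
      _ = 9 * Real.log (bigP D) ^ 2 := by ring
  -- the outer range: `h ≤ X`, `(h,𝔮) = 1`, `h > 1` ⇒ `D⁴ < h < ⌈P⌉`
  have hQ : ∀ p, p.Prime → p ≤ D ^ 4 → p ∣ frakq D := fun p hp' hp4 => prime_dvd_frakq hD2 hp' hp4
  have hsubh : (Icc 1 X).filter (fun h => Nat.Coprime h (frakq D) ∧ h ≠ 1) ⊆
      Finset.Ioo (D ^ 4) ⌈bigP D⌉₊ := by
    intro h hh
    rw [mem_filter, mem_Icc] at hh
    obtain ⟨⟨hh1, hhX⟩, hhQ, hh1'⟩ := hh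
    rw [Finset.mem_Ioo]
    exact ⟨lt_of_coprime_of_primes_dvd hQ (by omega) hh1' hhQ, by omega⟩
  have hmain := sum_coprime_norm_sub_le_swap χ (betaJ_re'' c' D j) (frakq D) X
  -- unfold the typed objects
  have hJ : ∀ n : ℕ, varrhoJ c' D j n =
      ∑ d ∈ n.divisors, (ArithmeticFunction.moebius d : ℂ) * (d : ℂ) ^ betaJ c' D j := fun n => rfl
  have hS : ∀ n : ℕ, varrhoStar c' χ j n =
      ∑ d ∈ n.divisors, ((d : ℕ) : ℂ) ^ betaJ c' D j * χ ((d : ℕ) : ZMod D) := fun n => rfl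
  simp only [hJ, hS, Ico_one_eq_Icc ⌈bigP D⌉₊]
  have hB : ∑ h ∈ Finset.Ioo (D ^ 4) ⌈bigP D⌉₊, ‖nu χ h‖ / h *
        ∑ m ∈ Finset.Ico 1 ⌈bigP D / h⌉₊, ((m.divisors.card : ℝ) / m) ≥ 0 :=
    sum_nonneg fun h _ => mul_nonneg (by positivity) (sum_nonneg fun m _ => by positivity)
  constructor
  · calc _ ≤ ∑ h ∈ (Icc 1 X).filter (fun h => Nat.Coprime h (frakq D) ∧ h ≠ 1),
            ‖divisorSumChar χ h‖ / h * ∑ m ∈ Icc 1 (X / h), ((m.divisors.card : ℝ) / m) := hmain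
      _ ≤ ∑ h ∈ (Icc 1 X).filter (fun h => Nat.Coprime h (frakq D) ∧ h ≠ 1),
            ‖nu χ h‖ / h * ∑ m ∈ Finset.Ico 1 ⌈bigP D / h⌉₊, ((m.divisors.card : ℝ) / m) := by
          refine sum_le_sum fun h hh => ?_
          have hh1 : 1 ≤ h := (mem_Icc.mp (mem_filter.mp hh).1).1
          exact mul_le_mul_of_nonneg_left (hinner_mono h hh1) (by positivity)
      _ ≤ ∑ h ∈ Finset.Ioo (D ^ 4) ⌈bigP D⌉₊,
            ‖nu χ h‖ / h * ∑ m ∈ Finset.Ico 1 ⌈bigP D / h⌉₊, ((m.divisors.card : ℝ) / m) :=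
          sum_le_sum_of_subset_of_nonneg hsubh fun h _ _ =>
            mul_nonneg (by positivity) (sum_nonneg fun m _ => by positivity)
      _ ≤ 9 * _ := le_mul_of_one_le_left hB (by norm_num)
  · rw [mul_sum]
    refine sum_le_sum fun h hh => ?_
    have hh1 : 1 ≤ h := by
      have := (Finset.mem_Ioo.mp hh).1
      have : 1 ≤ D ^ 4 := Nat.one_le_pow _ _ (by omega)
      omega
    calc ‖nu χ h‖ / h * ∑ m ∈ Finset.Ico 1 ⌈bigP D / h⌉₊, ((m.divisors.card : ℝ) / m)
        ≤ ‖nu χ h‖ / h * (9 * Real.log (bigP D) ^ 2) :=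
          mul_le_mul_of_nonneg_left (hinner_le h hh1) (by positivity)
      _ = 9 * Real.log (bigP D) ^ 2 * (‖nu χ h‖ / h) := by ring

variable (c' : ℝ) in
/-- `StepB_u004` — `_holds` alias of `stepB_u004_holds` above under the fact's exact name, stated under the
prover's own binders as section variables (appended 2026-08-28, D-0026 bookkeeping: the proof term is the
existing theorem of this file; no statement, definition or attribute is edited; no new named fact; the
ledger's debt table listed the fact unproved). [cite: Zhang2022LandauSiegel, App. B p.106] -/
theorem _root_.Literature.NumberTheory.LFunctions.Zhang2022.Typed.AppendixB.StepB_u004_holds :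
    _root_.Literature.NumberTheory.LFunctions.Zhang2022.Typed.AppendixB.StepB_u004 c' :=
  _root_.Literature.NumberTheory.LFunctions.Zhang2022.AppendixBVarrho.stepB_u004_holds (c' := c')

/-! ## §B.u006: "By (B.1) and (B.2) …" for the weights `ϰ₂`, `ϰ₃` -/

/-- **§B.u006 holds** (`Typed.AppendixB.StepB_u006 c′`): "By (B.1) and (B.2), for `μ = 2, 3`,
`Σ_{(l,𝔮)=1} ϰ_μ(l₁l)ϱ*_j(l)/l = Σ_l ϰ_μ(l₁l)ϱ_j(l)/l + O(𝓛⁻⁸)`" (under (A), `D` large): the difference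
is `Σ_{(l,𝔮)=1} ϰ_μ(l₁l)(ϱ*_j − ϱ_j)(l)/l − Σ_{(l,𝔮)>1} ϰ_μ(l₁l)ϱ_j(l)/l`, and `|ϰ_μ| ≤ 1`
(`Skeleton.norm_vk2_le/norm_vk3_le`), so (B.1) + (B.2) bound it by `(C₁ + C₂)𝓛⁻⁸`.
[cite: Zhang2022LandauSiegel, App. B p.107] -/
theorem stepB_u006_holds (c' : ℝ) : StepB_u006 c' := by
  obtain ⟨C₁, D₁, h₁⟩ := appB1_bound c'
  obtain ⟨C₂, D₂, h₂⟩ := appB2_bound c'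
  refine ⟨C₁ + C₂, max (max D₁ D₂) ⌈Real.exp 3⌉₊, fun D _ χ hD hq hp hA j _ l₁ _ _ _ vk hvk => ?_⟩
  have hD₁ : D₁ ≤ D := le_trans (le_trans (le_max_left _ _) (le_max_left _ _)) hD
  have hD₂ : D₂ ≤ D := le_trans (le_trans (le_max_right _ _) (le_max_left _ _)) hD
  have hDe : ⌈Real.exp 3⌉₊ ≤ D := le_trans (le_max_right _ _) hD
  have hexp3 : Real.exp 3 ≤ D := le_trans (Nat.le_ceil _) (by exact_mod_cast hDe)
  have hlog : 2 ≤ Real.log D := by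
    have h3 : 3 ≤ Real.log D :=
      (Real.le_log_iff_exp_le (lt_of_lt_of_le (Real.exp_pos 3) hexp3)).mpr hexp3
    linarith
  have hD3 : 3 ≤ D := by
    have h4 : (4 : ℝ) ≤ Real.exp 3 := by linarith [Real.add_one_le_exp (3 : ℝ)]
    exact_mod_cast (show (3 : ℝ) ≤ D by linarith)
  obtain ⟨hℓ, -, -, -⟩ := params_of_three_le hD3
  have hP1 : 1 ≤ bigP D := by
    unfold bigP; exact Real.one_le_exp_iff.mpr (by positivity)
  have hℓ8 : 0 < ell D ^ 8 := by positivity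
  -- `|ϰ(l₁ l)| ≤ 1` (tree: `Skeleton.norm_vk2_le`, `Skeleton.norm_vk3_le`, for `log D ≥ 2`)
  have hvk1 : ∀ l : ℕ, 1 ≤ l → ‖vk (l₁ * l)‖ ≤ 1 := by
    intro l _
    rcases hvk with rfl | rfl
    · exact norm_vk2_le hlog _
    · exact norm_vk3_le hlog _
  -- (B.1) and (B.2) on `[1, ⌈P⌉)`
  set X : ℕ := ⌈bigP D⌉₊ - 1 with hXdef
  have hX : X ≤ ⌊bigP D ^ 2⌋₊ := by
    have h1 : ⌈bigP D⌉₊ - 1 ≤ ⌊bigP D⌋₊ := by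
      have := Nat.ceil_le_floor_add_one (bigP D)
      omega
    exact h1.trans (Nat.floor_le_floor (by nlinarith))
  have hIco : Finset.Ico 1 ⌈bigP D⌉₊ = Icc 1 X := by
    ext n; simp only [Finset.mem_Ico, mem_Icc, hXdef]; omega
  have hB1 := h₁ D χ hD₁ hq hp hA j X hX
  have hB2 := h₂ D χ hD₂ hq hp j X hX
  -- unfold the typed objects and split the full sum
  have hJ : ∀ n : ℕ, varrhoJ c' D j n =
      ∑ d ∈ n.divisors, (ArithmeticFunction.moebius d : ℂ) * (d : ℂ) ^ betaJ c' D j := fun n => rfl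
  set A := (Finset.Ico 1 ⌈bigP D⌉₊).filter (fun l => Nat.Coprime l (frakq D)) with hAdef
  set B := (Finset.Ico 1 ⌈bigP D⌉₊).filter (fun l => ¬ Nat.Coprime l (frakq D)) with hBdef
  have hsplit : vkSum c' D vk j l₁ =
      (∑ l ∈ A, vk (l₁ * l) * varrhoJ c' D j l / (l : ℂ)) +
        ∑ l ∈ B, vk (l₁ * l) * varrhoJ c' D j l / (l : ℂ) := by
    rw [vkSum, hAdef, hBdef, Finset.sum_filter_add_sum_filter_not]
  rw [hsplit]
  have halg : (∑ l ∈ A, vk (l₁ * l) * varrhoStar c' χ j l / (l : ℂ)) -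
      ((∑ l ∈ A, vk (l₁ * l) * varrhoJ c' D j l / (l : ℂ)) +
        ∑ l ∈ B, vk (l₁ * l) * varrhoJ c' D j l / (l : ℂ)) =
      (∑ l ∈ A, vk (l₁ * l) * (varrhoStar c' χ j l - varrhoJ c' D j l) / (l : ℂ)) -
        ∑ l ∈ B, vk (l₁ * l) * varrhoJ c' D j l / (l : ℂ) := by
    rw [← sub_sub, ← Finset.sum_sub_distrib]
    congr 1
    exact Finset.sum_congr rfl fun l _ => by ring
  rw [halg]
  have hterm : ∀ l ∈ Finset.Ico 1 ⌈bigP D⌉₊, ∀ z : ℂ, ‖vk (l₁ * l) * z / (l : ℂ)‖ ≤ ‖z‖ / l := by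
    intro l hl z
    have hl1 : 1 ≤ l := (Finset.mem_Ico.mp hl).1
    rw [norm_div, norm_mul, Complex.norm_natCast]
    exact div_le_div_of_nonneg_right (mul_le_of_le_one_left (norm_nonneg _) (hvk1 l hl1))
      (Nat.cast_nonneg _)
  calc ‖(∑ l ∈ A, vk (l₁ * l) * (varrhoStar c' χ j l - varrhoJ c' D j l) / (l : ℂ)) -
        ∑ l ∈ B, vk (l₁ * l) * varrhoJ c' D j l / (l : ℂ)‖
      ≤ ‖∑ l ∈ A, vk (l₁ * l) * (varrhoStar c' χ j l - varrhoJ c' D j l) / (l : ℂ)‖ +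
          ‖∑ l ∈ B, vk (l₁ * l) * varrhoJ c' D j l / (l : ℂ)‖ := norm_sub_le _ _
    _ ≤ (∑ l ∈ A, ‖varrhoStar c' χ j l - varrhoJ c' D j l‖ / l) +
          ∑ l ∈ B, ‖varrhoJ c' D j l‖ / l := by
        gcongr
        · exact (norm_sum_le _ _).trans (sum_le_sum fun l hl => hterm l (mem_filter.mp hl).1 _)
        · exact (norm_sum_le _ _).trans (sum_le_sum fun l hl => hterm l (mem_filter.mp hl).1 _)
    _ ≤ C₁ / ell D ^ 8 + C₂ / ell D ^ 8 := by
        gcongr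
        · simp only [hAdef, hIco, norm_sub_rev (varrhoStar c' χ j _), hJ]
          exact hB1
        · simp only [hBdef, hIco, hJ]
          exact hB2
    _ = (C₁ + C₂) / ell D ^ 8 := by ring

variable (c' : ℝ) in
/-- `StepB_u006` — `_holds` alias of `stepB_u006_holds` above under the fact's exact name, stated under the
prover's own binders as section variables (appended 2026-08-28, D-0026 bookkeeping: the proof term is the
existing theorem of this file; no statement, definition or attribute is edited; no new named fact; the
ledger's debt table listed the fact unproved). [cite: Zhang2022LandauSiegel, App. B p.107] -/
theorem _root_.Literature.NumberTheory.LFunctions.Zhang2022.Typed.AppendixB.StepB_u006_holds :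
    _root_.Literature.NumberTheory.LFunctions.Zhang2022.Typed.AppendixB.StepB_u006 c' :=
  _root_.Literature.NumberTheory.LFunctions.Zhang2022.AppendixBVarrho.stepB_u006_holds (c' := c')


end Literature.NumberTheory.LFunctions.Zhang2022.AppendixBVarrho
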